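import Summits.BirchSwinnertonDyer.BirchSwinnertonDyer.Theorems.ThetaPartnerAtTwoSignedMainConjectureCMTwoRankZeroOfLocal
import Literature.NumberTheory.EllipticCurves.PAdicLFunctionFrickeSymmetryProofs
import Literature.NumberTheory.EllipticCurves.KuriharaNumberParityProofs
import Literature.NumberTheory.EllipticCurves.AtkinLehnerFrickeLevelProofs
import Literature.NumberTheory.EllipticCurves.PAdicLFunctionIntegralityAtTwoQuarterProofs
import Literature.NumberTheory.EllipticCurves.ModularParametrizationBCDTProofs
import HarnessLib

/-!
# Route `ThetaPartnerAtTwo`, crux K2r0P `SignedMainConjectureCMTwoRankZeroOfPub` (stmt-BirchSwinnertonDyer-24945),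
# line `rankzero` v14: at conductors `N ≡ ±1 (mod 8)` the UNIT ZONE IS EMPTY — `4 ∣` the level-`16` reading of
# `[0]⁺_f`, so `‖L(f,1)/Ω⁺_f‖₂ ≤ ½`, and (PUB) `2 ∣ #Ш(A)·∏c_ℓ(A)` for every rank-`0` CM curve of such conductor

Cell `bsd-wall`, width seat `bsd-wall-tp2-p2-w3` (g0) on the lead line `rankzero` (skeleton v14, stubs (LD±2^k)_A,
(μ♭)_A). THEOREMS ONLY (no `def`, no named fact, no `sorry`); helper `--supports` the crux; nothing about any
particular curve is asserted; BSD is not proved by any of this.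

The composition of the skeleton (`Theorems.signedMainConjectureCMTwoRankZero_body_of_pub_of_stubs`, p594360) splits the
crux class along the ZONE `2 ∣ #Ш(A)·∏c_ℓ(A)`: in the unit zone PUB alone suffices, off it the two research stubs are
load-bearing. This file shows, in the kernel and from the tree's Fricke symmetry of modular symbols alone, that the
unit zone is EMPTY whenever the conductor is `≡ ±1 (mod 8)` — e.g. for EVERY quadratic twist of `121b, 361a, 1849a,
4489a, 26569a` (`N = q²D² ≡ 1`) and every `j = 0` curve with `9 ∥ N` — so there the research stubs carry the whole
crux, and conversely `2 ∣ #Ш·∏c_ℓ` is a THEOREM (granted the printed inputs) rather than a case hypothesis. The seat's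
numerical census (crux dir `FLAT-CENSUS-CM-v1p1.md`: 762 isogeny classes of 2-inert CM curves, conductor `< 5·10⁵`)
shows the split `N ≡ 3 (8)` ↔ 126 unit-zone classes / `N ≡ 1 (8)` ↔ none, which this file explains.

MECHANISM (elementary; the `λ`-parity law `(−1)^{λ(L♭)} = −χ₈(N)` of
`Literature/Barriers/…/PAdicFunctionalEquationParityLambdaSharpFlatTwoProofs` is the Iwasawa-theoretic shadow of the same
symmetry, not used here). For a normalised newform `f` of ODD level `N` with rational coefficients, `a₂(f) = 0`, and
the Fricke sign `σ` (`f|w_N = −σ f`; `σ = w_E` at the conductor level):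
* Hecke at `2` (`a₂ = 0`, cusp `b/8`): `[b/16]⁺ + [(b+8)/16]⁺ = −[b/4]⁺ = [0]⁺/2` for odd `b` (§1);
* Fricke at denominator `16` (tree: `IsFrickeEigen.normalizedPlusSymbol_div_eq_mul`, `u v N ≡ −1 (16)`):
  `[3/16]⁺ = σ[5/16]⁺` if `N ≡ ±1 (16)`, `[1/16]⁺ = σ[7/16]⁺` if `N ≡ ±7 (16)` (§2) — for `N ≡ ±3 (8)` the symmetry
  pairs `1/16 ↔ 3/16` instead and says nothing about `[0]⁺`;
* hence for `σ = 1` and `N ≡ ±1 (mod 8)`: **`[0]⁺_f = 4·[b/16]⁺_f`** (`b = 3` resp. `1`), and with the tree's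
  `2`-integrality `‖2[x]⁺_f‖₂ ≤ 1` (`norm_two_mul_ratPlusSymbol_le_one_of_even`): **`‖[0]⁺_f‖₂ ≤ ½`** (§3).
* §4 (habitat): for `W` good at `2` with `a₂(W) = 0`, `L(W,1) ≠ 0`, newform `f`, `N_W ≡ ±1 (8)`: `‖[0]⁺_f‖₂ ≤ ½` and
  `1 ≤ ord₂ [0]⁺_f` — no layer-`0` FLAT certificate, `L♭(0)` is never a unit there.
* §5 (K2r0 currency): granted Burungale–Flach (`hBF`), modularity (`hmod`, `hLrat`), GZK (`hGZK`) and the `p = 2` period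
  fact (`h2`) BY NAME: **every CM `A/ℚ` of analytic rank `0`, good supersingular at `2` with `a₂ = 0` and
  `N_A ≡ ±1 (mod 8)` has `2 ∣ #Ш(A)·∏c_ℓ(A)`** (contrapositive of the lineage's
  `unitZone_of_not_two_dvd_shaOrder_mul_tamagawaProduct`, p585652).

References: B. Mazur, J. Tate, J. Teitelbaum, Invent. Math. 84 (1986) §I.4 (4.2), §I.8, §I.17 [MazurTateTeitelbaum1986Invent];
A. O. L. Atkin, J. Lehner, Math. Ann. 185 (1970) Thm. 3 [AtkinLehner1970]; R. Greenberg, LNM 1716 (1999) §1, §5 p. 181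
[GreenbergLNM1716]; A. Burungale, M. Flach, 2024, Thm. 1.1 [BurungaleFlach2024].
-/

set_option autoImplicit false
-- the Theorems namespace of this sub repeats the summit name by design (D-0017 nested layout)
set_option linter.dupNamespace false

noncomputable section

open scoped Classical NumberField MatrixGroups ModularForm

open NumberField IsDedekindDomain CongruenceSubgroup

namespace Summit.BirchSwinnertonDyer.BirchSwinnertonDyer.Theorems

open Literature.NumberTheory.EllipticCurves Literature.NumberTheory.GaloisRepresentations
  WeierstrassCurve Literature.NumberTheory.EllipticCurves.ModularForms Literature.NumberTheory.EllipticCurves.Rank1Residual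
  Summit.BirchSwinnertonDyer.Rank1Residual Summit.BirchSwinnertonDyer.Rank1Residual.Supersingular

namespace LevelModEight

/-! ## §1. Hecke at `2` with `a₂ = 0`: `[b/16]⁺ + [(b+8)/16]⁺ = −[b/4]⁺`, and `[b/4]⁺ = −[0]⁺/2` for odd `b` -/

section Symbols

variable {N : ℕ} [NeZero N] {f : CuspForm (Gamma0 N) 2}

/-- **Hecke at `2`, cusp `b/8`, `a₂ = 0`**: `0 = a₂[b/8]⁺ = [b/16]⁺ + [(b+8)/16]⁺ + [b/4]⁺` (MTT (4.2) with `p = 2`,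
`r = b/8`). [cite: MazurTateTeitelbaum1986Invent, §I.4 (4.2)] -/
theorem ratPlusSymbol_div_sixteen_add (hf : IsNewform0 f) (hQ : coeffField f = ⊥) (h2N : ¬ 2 ∣ N)
    (ha₂ : cuspCoeff f 2 = ((0 : ℤ) : ℂ)) (b : ℤ) :
    ratPlusSymbol f ((b : ℚ) / 16) + ratPlusSymbol f (((b : ℚ) + 8) / 16) = -ratPlusSymbol f ((b : ℚ) / 4) := by
  have h := intCast_mul_ratPlusSymbol 2 hf Nat.prime_two h2N ha₂ (ratCast_ratPlusSymbol_holds hf hQ) ((b : ℚ) / 8)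
  rw [Fin.sum_univ_two] at h
  simp only [Fin.val_zero, Fin.val_one, Nat.cast_zero, Nat.cast_one, Nat.cast_ofNat, Int.cast_zero, zero_mul] at h
  have e1 : ((b : ℚ) / 8 + 0) / 2 = (b : ℚ) / 16 := by ring
  have e2 : ((b : ℚ) / 8 + 1) / 2 = ((b : ℚ) + 8) / 16 := by ring
  have e3 : (2 : ℚ) * ((b : ℚ) / 8) = (b : ℚ) / 4 := by ring
  rw [e1, e2, e3] at h
  linarith

/-- `[3/4]⁺ = [1/4]⁺` (`3/4 = −1/4 + 1`; evenness and `1`-periodicity). [cite: MazurTateTeitelbaum1986Invent, §I.8] -/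
theorem ratPlusSymbol_three_quarters_eq (f : CuspForm (Gamma0 N) 2) :
    ratPlusSymbol f (3 / 4) = ratPlusSymbol f (1 / 4) := by
  have h : (3 / 4 : ℚ) = -(1 / 4) + ((1 : ℤ) : ℚ) := by norm_num
  rw [h, ratPlusSymbol_add_intCast_eq, ratPlusSymbol_neg]

/-- `[11/16]⁺ = [5/16]⁺` and `[9/16]⁺ = [7/16]⁺` (`11/16 = −5/16 + 1`, `9/16 = −7/16 + 1`).
[cite: MazurTateTeitelbaum1986Invent, §I.8] -/
theorem ratPlusSymbol_eleven_sixteenths_eq (f : CuspForm (Gamma0 N) 2) :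
    ratPlusSymbol f (11 / 16) = ratPlusSymbol f (5 / 16) ∧ ratPlusSymbol f (9 / 16) = ratPlusSymbol f (7 / 16) := by
  have h1 : (11 / 16 : ℚ) = -(5 / 16) + ((1 : ℤ) : ℚ) := by norm_num
  have h2 : (9 / 16 : ℚ) = -(7 / 16) + ((1 : ℤ) : ℚ) := by norm_num
  refine ⟨?_, ?_⟩
  · rw [h1, ratPlusSymbol_add_intCast_eq, ratPlusSymbol_neg]
  · rw [h2, ratPlusSymbol_add_intCast_eq, ratPlusSymbol_neg]

/-- **`[3/16]⁺ + [5/16]⁺ = [0]⁺/2` and `[1/16]⁺ + [7/16]⁺ = [0]⁺/2`** for a rational newform of odd level with `a₂ = 0`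
(§1 at `b = 3`, `b = 1`, with `[1/4]⁺ = [3/4]⁺ = −[0]⁺/2`). [cite: MazurTateTeitelbaum1986Invent, §I.4 (4.2) and §I.8] -/
theorem ratPlusSymbol_sixteenths_pair_sum (hf : IsNewform0 f) (hQ : coeffField f = ⊥) (h2N : ¬ 2 ∣ N)
    (ha₂ : cuspCoeff f 2 = ((0 : ℤ) : ℂ)) :
    ratPlusSymbol f (3 / 16) + ratPlusSymbol f (5 / 16) = ratPlusSymbol f 0 / 2 ∧
      ratPlusSymbol f (1 / 16) + ratPlusSymbol f (7 / 16) = ratPlusSymbol f 0 / 2 := by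
  have hq : ratPlusSymbol f (1 / 4) = -(ratPlusSymbol f 0) / 2 :=
    ratPlusSymbol_quarter_eq_of_cuspCoeff_two_eq_zero hf h2N (by rw [ha₂]; simp)
  have h3 := ratPlusSymbol_div_sixteen_add hf hQ h2N ha₂ 3
  have h1 := ratPlusSymbol_div_sixteen_add hf hQ h2N ha₂ 1
  have e3a : (((3 : ℤ) : ℚ) / 16) = 3 / 16 := by norm_num
  have e3b : ((((3 : ℤ) : ℚ) + 8) / 16) = 11 / 16 := by norm_num
  have e3c : (((3 : ℤ) : ℚ) / 4) = 3 / 4 := by norm_num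
  have e1a : (((1 : ℤ) : ℚ) / 16) = 1 / 16 := by norm_num
  have e1b : ((((1 : ℤ) : ℚ) + 8) / 16) = 9 / 16 := by norm_num
  have e1c : (((1 : ℤ) : ℚ) / 4) = 1 / 4 := by norm_num
  rw [e3a, e3b, e3c, (ratPlusSymbol_eleven_sixteenths_eq f).1, ratPlusSymbol_three_quarters_eq, hq] at h3
  rw [e1a, e1b, e1c, (ratPlusSymbol_eleven_sixteenths_eq f).2, hq] at h1
  constructor <;> linarith

/-! ## §2. Fricke at denominator `16`: `[3/16]⁺ = σ[5/16]⁺` (`N ≡ ±1 (16)`), `[1/16]⁺ = σ[7/16]⁺` (`N ≡ ±7 (16)`) -/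

/-- **Fricke symmetry at denominator `16`, `N ≡ ±1 (mod 16)`**: `[3/16]⁺_f = σ·[5/16]⁺_f` when `f(−1/(Nτ)) = −σNτ²f(τ)`
(`a·16 − 3·N·v = 1` with `v = ±5`; tree: `IsFrickeEigen.normalizedPlusSymbol_div_eq_mul`).
[cite: MazurTateTeitelbaum1986Invent, §I.17] [cite: AtkinLehner1970, Thm. 3] -/
theorem ratPlusSymbol_three_sixteenths_eq_mul (f : CuspForm (Gamma0 N) 2) {σ : ℤ} (hσ : σ ^ 2 = 1)
    (hW : IsFrickeEigen N f (-(σ : ℂ))) (hN : N % 16 = 1 ∨ N % 16 = 15) :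
    ratPlusSymbol f (3 / 16) = σ * ratPlusSymbol f (5 / 16) := by
  have hm : (0 : ℕ) < 16 := by norm_num
  rcases hN with h | h
  · -- `N = 16k + 1`, `a = 15k + 1`, `u = 3`, `v = 5`
    obtain ⟨k, hk⟩ : ∃ k : ℕ, N = 16 * k + 1 := ⟨N / 16, by omega⟩
    have huv : (15 * (k : ℤ) + 1) * ((16 : ℕ) : ℤ) - 3 * ((N : ℤ) * 5) = 1 := by
      rw [hk]; push_cast; ring
    have h := ratPlusSymbol_eq_mul_of_normalizedPlusSymbol_eq (f := f) hσ
      (IsFrickeEigen.normalizedPlusSymbol_div_eq_mul (f := f) hW hσ hm huv)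
    have e1 : (((3 : ℤ) : ℚ) / ((16 : ℕ) : ℚ)) = 3 / 16 := by norm_num
    have e2 : (((5 : ℤ) : ℚ) / ((16 : ℕ) : ℚ)) = 5 / 16 := by norm_num
    rwa [e1, e2] at h
  · -- `N = 16k + 15`, `a = −15k − 14`, `u = 3`, `v = −5`
    obtain ⟨k, hk⟩ : ∃ k : ℕ, N = 16 * k + 15 := ⟨N / 16, by omega⟩
    have huv : (-15 * (k : ℤ) - 14) * ((16 : ℕ) : ℤ) - 3 * ((N : ℤ) * (-5)) = 1 := by
      rw [hk]; push_cast; ring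
    have h := ratPlusSymbol_eq_mul_of_normalizedPlusSymbol_eq (f := f) hσ
      (IsFrickeEigen.normalizedPlusSymbol_div_eq_mul (f := f) hW hσ hm huv)
    have e1 : (((3 : ℤ) : ℚ) / ((16 : ℕ) : ℚ)) = 3 / 16 := by norm_num
    have e2 : (((-5 : ℤ) : ℚ) / ((16 : ℕ) : ℚ)) = -(5 / 16) := by norm_num
    rwa [e1, e2, ratPlusSymbol_neg] at h

/-- **Fricke symmetry at denominator `16`, `N ≡ ±7 (mod 16)`**: `[1/16]⁺_f = σ·[7/16]⁺_f` (`a·16 − 1·N·v = 1`, `v = ∓7`).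
[cite: MazurTateTeitelbaum1986Invent, §I.17] [cite: AtkinLehner1970, Thm. 3] -/
theorem ratPlusSymbol_one_sixteenth_eq_mul (f : CuspForm (Gamma0 N) 2) {σ : ℤ} (hσ : σ ^ 2 = 1)
    (hW : IsFrickeEigen N f (-(σ : ℂ))) (hN : N % 16 = 7 ∨ N % 16 = 9) :
    ratPlusSymbol f (1 / 16) = σ * ratPlusSymbol f (7 / 16) := by
  have hm : (0 : ℕ) < 16 := by norm_num
  rcases hN with h | h
  · -- `N = 16k + 7`, `a = −7k − 3`, `u = 1`, `v = −7`
    obtain ⟨k, hk⟩ : ∃ k : ℕ, N = 16 * k + 7 := ⟨N / 16, by omega⟩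
    have huv : (-7 * (k : ℤ) - 3) * ((16 : ℕ) : ℤ) - 1 * ((N : ℤ) * (-7)) = 1 := by
      rw [hk]; push_cast; ring
    have h := ratPlusSymbol_eq_mul_of_normalizedPlusSymbol_eq (f := f) hσ
      (IsFrickeEigen.normalizedPlusSymbol_div_eq_mul (f := f) hW hσ hm huv)
    have e1 : (((1 : ℤ) : ℚ) / ((16 : ℕ) : ℚ)) = 1 / 16 := by norm_num
    have e2 : (((-7 : ℤ) : ℚ) / ((16 : ℕ) : ℚ)) = -(7 / 16) := by norm_num
    rwa [e1, e2, ratPlusSymbol_neg] at h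
  · -- `N = 16k + 9`, `a = 7k + 4`, `u = 1`, `v = 7`
    obtain ⟨k, hk⟩ : ∃ k : ℕ, N = 16 * k + 9 := ⟨N / 16, by omega⟩
    have huv : (7 * (k : ℤ) + 4) * ((16 : ℕ) : ℤ) - 1 * ((N : ℤ) * 7) = 1 := by
      rw [hk]; push_cast; ring
    have h := ratPlusSymbol_eq_mul_of_normalizedPlusSymbol_eq (f := f) hσ
      (IsFrickeEigen.normalizedPlusSymbol_div_eq_mul (f := f) hW hσ hm huv)
    have e1 : (((1 : ℤ) : ℚ) / ((16 : ℕ) : ℚ)) = 1 / 16 := by norm_num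
    have e2 : (((7 : ℤ) : ℚ) / ((16 : ℕ) : ℚ)) = 7 / 16 := by norm_num
    rwa [e1, e2] at h

/-! ## §3. `N ≡ ±1 (mod 8)`, `σ = 1`: `[0]⁺_f = 4·[b/16]⁺_f` and `‖[0]⁺_f‖₂ ≤ ½` -/

/-- **`[0]⁺_f = 4·[b/16]⁺_f` at `N ≡ ±1 (mod 8)`, Fricke sign `+1`** (`b = 3` if `N ≡ ±1 (16)`, `b = 1` if
`N ≡ ±7 (16)`): the level-`16` plus symbols read the `L`-value with a factor `4`. For a rational newform of odd level
with `a₂ = 0` and `f(−1/(Nτ)) = −Nτ²f(τ)`. [cite: MazurTateTeitelbaum1986Invent, §I.4 (4.2), §I.8 and §I.17] -/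
theorem exists_ratPlusSymbol_zero_eq_four_mul (hf : IsNewform0 f) (hQ : coeffField f = ⊥) (h2N : ¬ 2 ∣ N)
    (ha₂ : cuspCoeff f 2 = ((0 : ℤ) : ℂ)) (hW : IsFrickeEigen N f (-((1 : ℤ) : ℂ)))
    (hN : N % 8 = 1 ∨ N % 8 = 7) :
    ∃ b : ℤ, (b = 3 ∨ b = 1) ∧ ratPlusSymbol f 0 = 4 * ratPlusSymbol f ((b : ℚ) / 16) := by
  obtain ⟨h35, h17⟩ := ratPlusSymbol_sixteenths_pair_sum hf hQ h2N ha₂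
  have hσ : ((1 : ℤ)) ^ 2 = 1 := by norm_num
  by_cases h16 : N % 16 = 1 ∨ N % 16 = 15
  · have hF := ratPlusSymbol_three_sixteenths_eq_mul f hσ hW h16
    refine ⟨3, Or.inl rfl, ?_⟩
    have e : (((3 : ℤ) : ℚ) / 16) = 3 / 16 := by norm_num
    rw [e]
    push_cast at hF
    linarith
  · have h16' : N % 16 = 7 ∨ N % 16 = 9 := by omega
    have hF := ratPlusSymbol_one_sixteenth_eq_mul f hσ hW h16'
    refine ⟨1, Or.inr rfl, ?_⟩
    have e : (((1 : ℤ) : ℚ) / 16) = 1 / 16 := by norm_num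
    rw [e]
    push_cast at hF
    linarith

/-- **`‖[0]⁺_f‖₂ ≤ ½` at `N ≡ ±1 (mod 8)`, Fricke sign `+1`, `a₂ = 0`**: `[0]⁺ = 2·(2[b/16]⁺)` and `2[x]⁺_f` is
`2`-integral for even `a₂` and `den x` prime to `N` (`norm_two_mul_ratPlusSymbol_le_one_of_even`). So the
`Ω⁺_f`-normalised `L`-value is EVEN in `ℤ₍₂₎` — such an `f` is never in the unit zone.
[cite: MazurTateTeitelbaum1986Invent, §I.8 and §I.17] -/
theorem norm_ratPlusSymbol_zero_le_half (hf : IsNewform0 f) (hQ : coeffField f = ⊥) (h2N : ¬ 2 ∣ N)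
    (ha₂ : cuspCoeff f 2 = ((0 : ℤ) : ℂ)) (hW : IsFrickeEigen N f (-((1 : ℤ) : ℂ)))
    (hN : N % 8 = 1 ∨ N % 8 = 7) :
    ‖((ratPlusSymbol f 0 : ℚ) : ℚ_[2])‖ ≤ 2⁻¹ := by
  obtain ⟨b, hb, h0⟩ := exists_ratPlusSymbol_zero_eq_four_mul hf hQ h2N ha₂ hW hN
  have hreal : ∀ n, (cuspCoeff f n).im = 0 := cuspCoeff_im_eq_zero_of_coeffField_eq_bot hQ
  have hden : (((b : ℚ) / 16)).den = 16 := by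
    rcases hb with rfl | rfl <;> norm_num
  have hcop : Nat.Coprime (((b : ℚ) / 16)).den N := by
    rw [hden]
    have h2 : Nat.Coprime 2 N := (Nat.Prime.coprime_iff_not_dvd Nat.prime_two).mpr h2N
    simpa using (Nat.Coprime.pow_left 4 h2)
  have hx := norm_two_mul_ratPlusSymbol_le_one_of_even hf hreal h2N ha₂ (by decide) hcop
  have h0' : ((ratPlusSymbol f 0 : ℚ) : ℚ_[2]) = 2 * (((2 * ratPlusSymbol f ((b : ℚ) / 16) : ℚ)) : ℚ_[2]) := by
    rw [h0]; push_cast; ring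
  rw [h0', norm_mul]
  have h2 : ‖(2 : ℚ_[2])‖ = 2⁻¹ := by
    have h := Padic.norm_p (p := 2)
    simpa using h
  rw [h2]
  calc (2⁻¹ : ℝ) * ‖(((2 * ratPlusSymbol f ((b : ℚ) / 16) : ℚ)) : ℚ_[2])‖ ≤ 2⁻¹ * 1 := by gcongr
    _ = 2⁻¹ := mul_one _

end Symbols

/-! ## §4. Habitat reading: `W` good at `2`, `a₂(W) = 0`, `L(W,1) ≠ 0`, `N_W ≡ ±1 (mod 8)` -/

section Habitat

variable {W : WeierstrassCurve ℚ} [W.IsElliptic] [W.IsGloballyMinimal] [NeZero (W.conductorNorm ℤ)]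
  {f : CuspForm (Gamma0 (W.conductorNorm ℤ)) 2}

/-- **No unit zone at `N_W ≡ ±1 (mod 8)`**: for `W/ℚ` with good reduction at `2`, `a₂(W) = 0`, `L(W,1) ≠ 0` and newform
`f` at the conductor level, `‖L(f,1)/Ω⁺_f‖₂ ≤ ½` whenever `N_W ≡ ±1 (mod 8)` (root number `+1`:
`rootNumber_eq_one_of_entireLFunction_one_ne_zero`; Fricke sign of the newform `= −w(E)`: `IsNewformOf.isFrickeEigen_neg_rootNumber`).
[cite: AtkinLehner1970, Thm. 3] [cite: MazurTateTeitelbaum1986Invent, §I.17] -/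
theorem norm_ratPlusSymbol_zero_le_half_of_isNewformOf (hf : IsNewformOf W f) (hgood : W.HasGoodReductionAtPrime 2)
    (ha : W.frobeniusTrace 2 = 0) (hL : W.entireLFunction 1 ≠ 0)
    (hN : W.conductorNorm ℤ % 8 = 1 ∨ W.conductorNorm ℤ % 8 = 7) :
    ‖((ratPlusSymbol f 0 : ℚ) : ℚ_[2])‖ ≤ 2⁻¹ := by
  have hw : W.rootNumber = 1 := WeierstrassCurve.rootNumber_eq_one_of_entireLFunction_one_ne_zero hL
  have hFr : IsFrickeEigen (W.conductorNorm ℤ) f (-((1 : ℤ) : ℂ)) := by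
    have h := hf.isFrickeEigen_neg_rootNumber
    rwa [hw] at h
  have hap : cuspCoeff f 2 = ((0 : ℤ) : ℂ) := by
    rw [cuspCoeff_eq_frobeniusTrace_of_isNewformOf_holds hf hgood, ha]
  exact norm_ratPlusSymbol_zero_le_half hf.1 hf.coeffField_eq_bot (not_dvd_level_of_isNewformOf hf hgood) hap hFr hN

/-- **`ord₂ [0]⁺_f ≥ 1` at `N_W ≡ ±1 (mod 8)`** (same hypotheses; `[0]⁺_f ≠ 0` from `L(W,1) ≠ 0`): the `padicValRat`
currency of the lineage's zone lemma `unitZone_of_not_two_dvd_shaOrder_mul_tamagawaProduct`.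
[cite: MazurTateTeitelbaum1986Invent, §I.17] -/
theorem one_le_padicValRat_ratPlusSymbol_zero_of_isNewformOf (hf : IsNewformOf W f)
    (hgood : W.HasGoodReductionAtPrime 2) (ha : W.frobeniusTrace 2 = 0) (hL : W.entireLFunction 1 ≠ 0)
    (hN : W.conductorNorm ℤ % 8 = 1 ∨ W.conductorNorm ℤ % 8 = 7) :
    1 ≤ padicValRat 2 (ratPlusSymbol f 0) := by
  have hs0 : ratPlusSymbol f 0 ≠ 0 := fun h ↦ hL (by rw [hf.entireLFunction_one_eq, h]; simp)
  have hn := norm_ratPlusSymbol_zero_le_half_of_isNewformOf hf hgood ha hL hN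
  have hq0 : ((ratPlusSymbol f 0 : ℚ) : ℚ_[2]) ≠ 0 := by exact_mod_cast hs0
  rw [Padic.norm_eq_zpow_neg_valuation hq0, Padic.valuation_ratCast] at hn
  have h2 : (2⁻¹ : ℝ) = (2 : ℝ) ^ (-1 : ℤ) := by norm_num
  rw [h2] at hn
  have hmono := (zpow_le_zpow_iff_right₀ (by norm_num : (1 : ℝ) < 2)).mp (by exact_mod_cast hn)
  omega

end Habitat

/-! ## §5. K2r0 currency: PUB ⟹ `2 ∣ #Ш(A)·∏c_ℓ(A)` for every rank-`0` CM `A`, good ss at `2`, `a₂ = 0`, `N_A ≡ ±1 (8)` -/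

section Zone

/-- **At conductors `≡ ±1 (mod 8)` the unit zone of crux K2r0P is EMPTY.** Grant BY NAME Burungale–Flach's BSD triple for CM
`L(A,1) ≠ 0` (`hBF`), modularity (`hmod`: a newform exists; `hLrat`: entire `L`), GZK (`hGZK`) and the `p = 2` period fact
(`h2`). Then every CM `A/ℚ` (globally minimal) of analytic rank `0`, good supersingular at `2` with `a₂ = 0` and
`N_A ≡ ±1 (mod 8)` has `2 ∣ #Ш(A)·∏c_ℓ(A)`: otherwise the lineage's zone lemma gives `ord₂ [0]⁺_f = 0` for the newform `f`
and the period ratio `ϖ = u⁻¹` of `h2`, against `ord₂ [0]⁺_f ≥ 1` (§4). On these `A` the research stubs (LD±2^k)_A, (μ♭)_A of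
line `rankzero` are load-bearing with no unit-zone escape. [cite: BurungaleFlach2024, Thm. 1.1]
[cite: MazurTateTeitelbaum1986Invent, §I.17] [cite: AtkinLehner1970, Thm. 3] -/
theorem two_dvd_shaOrder_mul_tamagawaProduct_of_conductorNorm_mod_eight
    (hBF : bsdTriple_of_hasCM_of_L_one_ne_zero) (hmod : nonempty_modularParametrizationData)
    (hLrat : hasEntireLFunction_rat) (hGZK : rank_eq_analyticRank_of_analyticRank_le_one)
    (h2 : Literature.NumberTheory.EllipticCurves.realPeriodRat_eq_unit_mul_plusPeriod_two)
    (A : WeierstrassCurve ℚ) [A.IsElliptic] [A.IsGloballyMinimal]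
    (hcm : A.HasCM) (hr : A.analyticRank = 0) (hss : GoodSS A 2) (ha : A.frobeniusTrace 2 = 0)
    (hN : A.conductorNorm ℤ % 8 = 1 ∨ A.conductorNorm ℤ % 8 = 7) :
    2 ∣ A.shaOrder * A.tamagawaProduct := by
  by_contra hunit
  haveI : NeZero (A.conductorNorm ℤ) := ⟨(A.conductorNorm_pos_holds).ne'⟩
  obtain ⟨f, hf⟩ := exists_isNewformOf_of_nonempty_modularParametrizationData hmod A
  obtain ⟨u, hu1, hu⟩ := h2 A hss.1 (P2.irr_two_of_goodSS_two A hss) f hf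
  have hu0 : u ≠ 0 := by
    rintro rfl
    simp at hu1
  have hϖ : (((u⁻¹ : ℚ)) : ℝ) * A.realPeriodRat = plusPeriod f := by
    rw [hu]; push_cast; field_simp
  obtain ⟨-, hv0⟩ := unitZone_of_not_two_dvd_shaOrder_mul_tamagawaProduct A hBF hLrat hGZK h2 hcm hr hss hunit f hf
    u⁻¹ hϖ
  have hL : A.entireLFunction 1 ≠ 0 := (A.analyticRank_eq_zero_iff_holds (hLrat A)).mp hr
  have h1 := one_le_padicValRat_ratPlusSymbol_zero_of_isNewformOf hf hss.1 ha hL hN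
  rw [hv0] at h1
  exact absurd h1 (by norm_num)

end Zone

end LevelModEight

end Summit.BirchSwinnertonDyer.BirchSwinnertonDyer.Theorems

end
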